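import Mathlib
import Summits.MatrixMultiplication.MatrixMultiplication.Theses.HiddenToeplitzCorners

/-!
# Stub `stub_instance` — crux `HiddenCorners` (stmt-MatrixMultiplication-7492),
# line `ApolarSketch`

Per-instance packaging, pure matrix algebra: from any placement
`W : ℕ → Matrix (Fin r) (Fin r) ℂ` build the Toeplitz pencil `T a b i j := W (i + rev j) b a`
(the Hankel matrix of `k ↦ W k b a` with its columns reversed).  It satisfies the split Stein
identity `T - Z T Zᵀ = e₀ (row 0)ᵀ + (col 0)′ e₀ᵀ` with generators of length `1`, its generator
sparsity is exactly `Σ_{k < 2N-1} nnz (W k)`, and `Σ X a b • T a b = H_W(X) · J`, so its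
determinant vanishes iff the Hankel determinant does.
-/

set_option linter.dupNamespace false

namespace Summit.MatrixMultiplication.MatrixMultiplication.Cruxes.HiddenCorners.ApolarSketch

open Summit.MatrixMultiplication.MatrixMultiplication.Theses.HiddenToeplitzCorners
open scoped BigOperators Matrix

/-- Left multiplication by the lower shift kills row `0`. -/
private theorem shift_mul_apply_zero (n : ℕ) (M : Matrix (Fin (n + 1)) (Fin (n + 1)) ℂ)
    (l : Fin (n + 1)) :
    ((Matrix.of fun p q : Fin (n + 1) => if (p : ℕ) = (q : ℕ) + 1 then (1 : ℂ) else 0) * M) 0 l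
      = 0 := by
  rw [Matrix.mul_apply]
  refine Finset.sum_eq_zero fun k _ => ?_
  simp [Matrix.of_apply]

/-- Left multiplication by the lower shift moves row `i` to row `i + 1`. -/
private theorem shift_mul_apply_succ (n : ℕ) (M : Matrix (Fin (n + 1)) (Fin (n + 1)) ℂ)
    (i : Fin n) (l : Fin (n + 1)) :
    ((Matrix.of fun p q : Fin (n + 1) => if (p : ℕ) = (q : ℕ) + 1 then (1 : ℂ) else 0) * M)
        i.succ l
      = M i.castSucc l := by
  rw [Matrix.mul_apply, Finset.sum_eq_single i.castSucc]
  · simp [Matrix.of_apply]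
  · intro k _ hk
    have hne : (i : ℕ) ≠ (k : ℕ) := fun h => hk (Fin.ext (by simp [h]))
    simp [Matrix.of_apply, hne]
  · intro h
    exact absurd (Finset.mem_univ _) h

/-- Right multiplication by the transposed lower shift kills column `0`. -/
private theorem mul_shift_transpose_apply_zero (n : ℕ)
    (M : Matrix (Fin (n + 1)) (Fin (n + 1)) ℂ) (i : Fin (n + 1)) :
    (M * (Matrix.of fun p q : Fin (n + 1) => if (p : ℕ) = (q : ℕ) + 1 then (1 : ℂ) else 0)ᵀ)
        i 0
      = 0 := by
  rw [Matrix.mul_apply]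
  refine Finset.sum_eq_zero fun k _ => ?_
  simp [Matrix.of_apply, Matrix.transpose_apply]

/-- Right multiplication by the transposed lower shift moves column `j` to column `j + 1`. -/
private theorem mul_shift_transpose_apply_succ (n : ℕ)
    (M : Matrix (Fin (n + 1)) (Fin (n + 1)) ℂ) (i : Fin (n + 1)) (j : Fin n) :
    (M * (Matrix.of fun p q : Fin (n + 1) => if (p : ℕ) = (q : ℕ) + 1 then (1 : ℂ) else 0)ᵀ)
        i j.succ
      = M i j.castSucc := by
  rw [Matrix.mul_apply, Finset.sum_eq_single j.castSucc]
  · simp [Matrix.of_apply, Matrix.transpose_apply]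
  · intro k _ hk
    have hne : (j : ℕ) ≠ (k : ℕ) := fun h => hk (Fin.ext (by simp [h]))
    simp [Matrix.of_apply, Matrix.transpose_apply, hne]
  · intro h
    exact absurd (Finset.mem_univ _) h

/-- The split Stein identity for one Toeplitz block `A i j = w (i + rev j)` of size `n + 1`:
`A - Z A Zᵀ = e₀ (row 0 of A)ᵀ + (column 0 of A with its corner zeroed) e₀ᵀ`. -/
private theorem stein_succ (n : ℕ) (w : ℕ → ℂ) (A : Matrix (Fin (n + 1)) (Fin (n + 1)) ℂ)
    (hA : ∀ i j, A i j = w ((i : ℕ) + (Fin.rev j : ℕ)))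
    (e g h : Matrix (Fin (n + 1)) (Fin 1) ℂ)
    (he : ∀ i u, e i u = if (i : ℕ) = 0 then 1 else 0)
    (hg : ∀ i u, g i u = if (i : ℕ) = 0 then 0 else w ((i : ℕ) + (n + 1 - 1)))
    (hh : ∀ j u, h j u = w (Fin.rev j : ℕ)) :
    A - (Matrix.of fun p q : Fin (n + 1) => if (p : ℕ) = (q : ℕ) + 1 then (1 : ℂ) else 0) * A
        * (Matrix.of fun p q : Fin (n + 1) => if (p : ℕ) = (q : ℕ) + 1 then (1 : ℂ) else 0)ᵀ
      = e * hᵀ + g * eᵀ := by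
  ext i j
  rw [Matrix.sub_apply, Matrix.add_apply, Matrix.mul_apply (M := e), Matrix.mul_apply (M := g),
    Fin.sum_univ_one, Fin.sum_univ_one, Matrix.transpose_apply, Matrix.transpose_apply, he, hg, hh,
    he]
  obtain rfl | ⟨i', rfl⟩ := i.eq_zero_or_eq_succ
  · rw [Matrix.mul_assoc, shift_mul_apply_zero, hA]
    simp
  · obtain rfl | ⟨j', rfl⟩ := j.eq_zero_or_eq_succ
    · rw [mul_shift_transpose_apply_zero, hA]
      simp
    · rw [mul_shift_transpose_apply_succ, shift_mul_apply_succ, hA, hA]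
      simp only [Fin.val_succ, Fin.val_castSucc, Fin.val_rev]
      have hidx :
          (i' : ℕ) + 1 + (n + 1 - ((j' : ℕ) + 1 + 1)) = (i' : ℕ) + (n + 1 - ((j' : ℕ) + 1)) := by
        omega
      rw [hidx]
      simp

/-- Generator sparsity of one block: the zeroed column `g` and the row `h` together carry exactly
`#{k < 2(n+1) - 1 : w k ≠ 0}` nonzero entries. -/
private theorem sparse_succ (n : ℕ) (w : ℕ → ℂ) (g h : Matrix (Fin (n + 1)) (Fin 1) ℂ)
    (hg : ∀ i u, g i u = if (i : ℕ) = 0 then 0 else w ((i : ℕ) + (n + 1 - 1)))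
    (hh : ∀ j u, h j u = w (Fin.rev j : ℕ)) :
    (Finset.univ.filter fun p : Fin (n + 1) × Fin 1 => g p.1 p.2 ≠ 0).card
      + (Finset.univ.filter fun p : Fin (n + 1) × Fin 1 => h p.1 p.2 ≠ 0).card
      = ((Finset.range (2 * (n + 1) - 1)).filter fun k => w k ≠ 0).card := by
  simp only [Finset.card_filter, Fintype.sum_prod_type, Fin.sum_univ_one, hg, hh]
  have h2 : 2 * (n + 1) - 1 = (n + 1) + n := by omega
  rw [h2, Finset.sum_range_add, Fin.sum_univ_succ, add_comm]
  congr 1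
  · rw [← Fin.sum_univ_eq_sum_range (fun k => if w k ≠ 0 then 1 else 0) (n + 1)]
    exact Fintype.sum_equiv Fin.revPerm _ _ fun j => rfl
  · rw [← Fin.sum_univ_eq_sum_range (fun k => if w (n + 1 + k) ≠ 0 then 1 else 0) n]
    simp only [Fin.val_zero, if_true, ne_eq, not_true_eq_false, if_false, zero_add, Fin.val_succ,
      Nat.add_one_ne_zero, Nat.add_sub_cancel]
    refine Finset.sum_congr rfl fun i _ => ?_
    rw [show (i : ℕ) + 1 + n = n + 1 + (i : ℕ) by omega]

/-- Exchanging the order of summation in the sparsity count: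
`Σ_{a b} #{k < M : W k b a ≠ 0} = Σ_{k < M} nnz (W k)`. -/
private theorem sum_card_swap (r M : ℕ) (W : ℕ → Matrix (Fin r) (Fin r) ℂ) :
    ∑ a : Fin r, ∑ b : Fin r, ((Finset.range M).filter fun k => W k b a ≠ 0).card
      = ∑ k ∈ Finset.range M,
          (Finset.univ.filter fun p : Fin r × Fin r => W k p.1 p.2 ≠ 0).card := by
  simp only [Finset.card_filter, Fintype.sum_prod_type]
  calc ∑ a : Fin r, ∑ b : Fin r, ∑ k ∈ Finset.range M, (if W k b a ≠ 0 then 1 else 0)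
        = ∑ a : Fin r, ∑ k ∈ Finset.range M, ∑ b : Fin r, (if W k b a ≠ 0 then 1 else 0) :=
          Finset.sum_congr rfl fun a _ => Finset.sum_comm
    _ = ∑ k ∈ Finset.range M, ∑ a : Fin r, ∑ b : Fin r, (if W k b a ≠ 0 then 1 else 0) :=
          Finset.sum_comm
    _ = ∑ k ∈ Finset.range M, ∑ b : Fin r, ∑ a : Fin r, (if W k b a ≠ 0 then 1 else 0) :=
          Finset.sum_congr rfl fun k _ => Finset.sum_comm

/-- The pencil `Σ X a b • T a b` is the Hankel trace matrix with its columns reversed, so the two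
determinants vanish together. -/
private theorem det_iff (r N : ℕ) (W : ℕ → Matrix (Fin r) (Fin r) ℂ)
    (T : Fin r → Fin r → Matrix (Fin N) (Fin N) ℂ)
    (hT : ∀ a b i j, T a b i j = W ((i : ℕ) + (Fin.rev j : ℕ)) b a)
    (X : Matrix (Fin r) (Fin r) ℂ) :
    (∑ a : Fin r, ∑ b : Fin r, X a b • T a b).det = 0 ↔
      (Matrix.of fun i j : Fin N => (X * W ((i : ℕ) + (j : ℕ))).trace).det = 0 := by
  have hsub : (∑ a : Fin r, ∑ b : Fin r, X a b • T a b) =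
      (Matrix.of fun i j : Fin N => (X * W ((i : ℕ) + (j : ℕ))).trace).submatrix id
        (Fin.revPerm : Equiv.Perm (Fin N)) := by
    ext i j
    simp [Matrix.sum_apply, hT, Matrix.trace, Matrix.mul_apply]
  rw [hsub, Matrix.det_permute', mul_eq_zero, or_iff_right]
  rcases Int.units_eq_one_or (Equiv.Perm.sign (Fin.revPerm : Equiv.Perm (Fin N))) with h | h <;>
    simp [h]

/-- STUB 1 — instance packaging: every honest Hankel placement `W` yields a Toeplitz pencil with
split Stein generators of length `d = 1`, generator sparsity at most `Σ_{k < 2N-1} nnz (W k)`, and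
the same singular locus as the Hankel pencil `X ↦ [tr (X * W (i + j))]`.  Witnesses:
`T a b := Matrix.of fun i j => W (i + rev j) b a`, `G₀ = H₀ := e₀`, `H₁ a b` = row `0` of
`T a b`, `G₁ a b` = column `0` of `T a b` with its corner zeroed; for `N = 0` everything is
empty. -/
theorem stub_instance (r N : ℕ) (W : ℕ → Matrix (Fin r) (Fin r) ℂ) :
    ∃ (T : Fin r → Fin r → Matrix (Fin N) (Fin N) ℂ) (G₀ H₀ : Matrix (Fin N) (Fin 1) ℂ)
      (G₁ H₁ : Fin r → Fin r → Matrix (Fin N) (Fin 1) ℂ),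
      (∀ a b : Fin r, T a b
          - (Matrix.of fun i j : Fin N => if (i : ℕ) = (j : ℕ) + 1 then (1 : ℂ) else 0) * T a b
            * (Matrix.of fun i j : Fin N => if (i : ℕ) = (j : ℕ) + 1 then (1 : ℂ) else 0)ᵀ
          = G₀ * (H₁ a b)ᵀ + G₁ a b * H₀ᵀ) ∧
      (∑ a : Fin r, ∑ b : Fin r,
          ((Finset.univ.filter fun p : Fin N × Fin 1 => G₁ a b p.1 p.2 ≠ 0).card
            + (Finset.univ.filter fun p : Fin N × Fin 1 => H₁ a b p.1 p.2 ≠ 0).card)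
        ≤ ∑ k ∈ Finset.range (2 * N - 1),
            (Finset.univ.filter fun p : Fin r × Fin r => W k p.1 p.2 ≠ 0).card) ∧
      ∀ X : Matrix (Fin r) (Fin r) ℂ,
        (∑ a : Fin r, ∑ b : Fin r, X a b • T a b).det = 0 ↔
          (Matrix.of fun i j : Fin N => (X * W ((i : ℕ) + (j : ℕ))).trace).det = 0 := by
  refine ⟨fun a b => Matrix.of fun i j : Fin N => W ((i : ℕ) + (Fin.rev j : ℕ)) b a,
    Matrix.of fun (i : Fin N) (_ : Fin 1) => if (i : ℕ) = 0 then (1 : ℂ) else 0,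
    Matrix.of fun (i : Fin N) (_ : Fin 1) => if (i : ℕ) = 0 then (1 : ℂ) else 0,
    fun a b => Matrix.of fun (i : Fin N) (_ : Fin 1) =>
      if (i : ℕ) = 0 then (0 : ℂ) else W ((i : ℕ) + (N - 1)) b a,
    fun a b => Matrix.of fun (j : Fin N) (_ : Fin 1) => W (Fin.rev j : ℕ) b a, ?_, ?_, ?_⟩
  · -- (i) the split Stein identity
    intro a b
    cases N with
    | zero => ext i j; exact i.elim0
    | succ n =>
      exact stein_succ n (fun k => W k b a) _ (fun _ _ => rfl) _ _ _ (fun _ _ => rfl)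
        (fun _ _ => rfl) (fun _ _ => rfl)
  · -- (ii) generator sparsity
    cases N with
    | zero => simp
    | succ n =>
      calc ∑ a : Fin r, ∑ b : Fin r,
            ((Finset.univ.filter fun p : Fin (n + 1) × Fin 1 =>
                (Matrix.of fun (i : Fin (n + 1)) (_ : Fin 1) =>
                  if (i : ℕ) = 0 then (0 : ℂ) else W ((i : ℕ) + (n + 1 - 1)) b a) p.1 p.2
                    ≠ 0).card
              + (Finset.univ.filter fun p : Fin (n + 1) × Fin 1 =>
                (Matrix.of fun (j : Fin (n + 1)) (_ : Fin 1) => W (Fin.rev j : ℕ) b a) p.1 p.2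
                  ≠ 0).card)
          = ∑ a : Fin r, ∑ b : Fin r,
              ((Finset.range (2 * (n + 1) - 1)).filter fun k => W k b a ≠ 0).card := by
            refine Finset.sum_congr rfl fun a _ => Finset.sum_congr rfl fun b _ => ?_
            exact sparse_succ n (fun k => W k b a) _ _ (fun _ _ => rfl) (fun _ _ => rfl)
        _ = ∑ k ∈ Finset.range (2 * (n + 1) - 1),
              (Finset.univ.filter fun p : Fin r × Fin r => W k p.1 p.2 ≠ 0).card :=
            sum_card_swap r _ W
        _ ≤ _ := le_rfl
  · -- (iii) the determinants vanish together
    intro X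
    exact det_iff r N W _ (fun _ _ _ _ => rfl) X

end Summit.MatrixMultiplication.MatrixMultiplication.Cruxes.HiddenCorners.ApolarSketch
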